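import Literature.NumberTheory.Transcendental.HyperlogarithmsRegularised
import HarnessLib

/-!
# Hyperlogarithms on `(0,1)`, IV: the endpoint `1`, regularised values and the generalised associator

Fourth layer of the analytic road to `GenusZeroPeriodsMZV` (see `Hyperlogarithms.lean`,
`HyperlogarithmsRegularised.lean`): the behaviour of the hyperlogarithms of a FINITE real alphabet
`{0} ∪ [1,∞)` (`[Fintype α]`; letter `z` at `0`, letter `o` at `1`) at the upper endpoint `b → 1⁻`,
and their regularised values there. Everything is PROVED; no named fact is introduced.

* `Hyperlog.IsTopReg σ W` — words regular at `1` (not starting with the letter at `1`); for such a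
  nonempty word the iterated integral over `[x,b]` is `O(1-x)` uniformly in `b < 1`
  (`iterInt_pden_le_of_isTopReg`, the head-bounded refined bound of `DrinfeldAssociatorTransport`,
  the non-singular densities being bounded by `Hyperlog.topBound`).
* `Hyperlog.hlogAt1 σ W = L_W(1) := lim_{b→1⁻} L_W(b)` for DOUBLY regular `W` (monotone limit,
  `tendsto_hlogAt1`, with the rate `hlogAt1_sub_le`
  `0 ≤ L_W(1) - L_W(b) ≤ C_W (1+|log(1-b)|)^{|W|} (1-b)`): the generalised multiple polylogarithm
  values of the letter configuration; for `{0,1}` the multiple zeta values `ζ(W) = Li_W(1)`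
  [Brown 2009, Def. 5.10] (`hlogAt1_boolLetters`).
* `Hyperlog.hlogReg2 σ z o W b = ⟨L(b), reg_{z,o} W⟩` and the **two-sided factorisation**
  `L(b) = exp(-log(1-b)·o) · ⟨L(b), reg_{z,o} ·⟩ · exp(log b · z)` (`hlogSeries_factorisation`; IKZ's
  two-sided regularisation `Shuffle.reg` and `Shuffle.factorisation` of
  `DrinfeldAssociatorRegularisation.lean` applied to the group-like series `L(b)` of
  `HyperlogarithmsRegularised.lean`, with `L(b)_{[z]} = log b`, `L(b)_{[o]} = -log(1-b)`).
* `Hyperlog.genAssoc σ z o W = Z^σ_W := Σ_v (reg_{z,o} W)_v L_v(1)` — **the regularised values at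
  `1` / generalised Drinfeld associator of the alphabet**: `⟨L(b), reg W⟩ → Z^σ_W` as `b → 1⁻`
  (`tendsto_hlogReg2`), `Z^σ` is GROUP-LIKE (`isGroupLike_genAssoc`), and for the alphabet `{0,1}`
  `Z^{0,1}_W = Z(reg W) = MZV.zetaWordSum (MZV.shuffleReg W)` (`genAssoc_boolLetters`), i.e.
  `(-1)^{dp W}` times the coefficient of `W` in the tree's `drinfeldAssociator`
  [Furusho2003, Prop. 3.2.3] — "the regularised value of `L(z)` at `1` is Drinfeld's associator"
  [Brown 2009, §5.5].

## References

* F. C. S. Brown, *Multiple zeta values and periods of moduli spaces `𝔐̄_{0,n}`*, Ann. Sci. Éc.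
  Norm. Supér. (4) 42 (2009), 371–489, §5.5 (p. 444: (5.12), (5.13), Def. 5.10).
  doi:10.24033/asens.2099. [BrownENS2009]
* K. Ihara, M. Kaneko, D. Zagier, *Derivation and double shuffle relations for multiple zeta
  values*, Compos. Math. 142 (2006), §3 (reg_ш), Cor. 5. [IharaKanekoZagier2006]
* H. Furusho, *The multiple zeta value algebra and the stable derivation algebra*, Publ. RIMS 39
  (2003), §3.2, Prop. 3.2.3. [Furusho2003]
-/

noncomputable section

open MeasureTheory intervalIntegral Set Filter
open scoped BigOperators Topology

namespace Literature.NumberTheory.Transcendental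

namespace Hyperlog

variable {α : Type*} (σ : α → ℝ)

/-! ### The top endpoint `b → 1⁻`: doubly regular words and their values at `1` -/

section TopEndpoint

variable [Fintype α] [DecidableEq α]

/-- Words *regular at `1`*: empty, or not STARTING with a letter placed at `1` (outermost form not
`dt/(1-t)`), the mirror image of `IsReg`. [folklore] -/
def IsTopReg (σ : α → ℝ) (W : List α) : Prop := ∀ h : W ≠ [], σ (W.head h) ≠ 1

/-- The bound of the non-singular densities on `(x/2, 1)`: `1/t ≤ 2/x`, `1/(σ_c - t) ≤ 1/(σ_c - 1)`
for `σ_c > 1`. [folklore] -/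
def topBound (σ : α → ℝ) (x : ℝ) : ℝ := 2 / x + ∑ c, if 1 < σ c then 1 / (σ c - 1) else 0

omit [DecidableEq α] in
/-- `2/x ≤ topBound`, and each `1/(σ_c - 1)` is below it. [folklore] -/
theorem topBound_ge (x : ℝ) : 2 / x ≤ topBound σ x ∧ ∀ c, 1 < σ c → 1 / (σ c - 1) ≤ topBound σ x - 2 / x := by
  have hnn : ∀ c, 0 ≤ (if 1 < σ c then 1 / (σ c - 1) else 0 : ℝ) := fun c => by
    split_ifs with h
    · have : 0 < σ c - 1 := by linarith
      positivity
    · exact le_rfl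
  refine ⟨le_add_of_nonneg_right (Finset.sum_nonneg fun c _ => hnn c), fun c hc => ?_⟩
  rw [topBound, add_sub_cancel_left]
  have := Finset.single_le_sum (fun d _ => hnn d) (Finset.mem_univ c)
  simpa [hc] using this

variable {σ} (hσ : ∀ c, σ c = 0 ∨ 1 ≤ σ c)
include hσ

omit [Fintype α] [DecidableEq α] hσ in
/-- The prefix of a top-regular word is top-regular. [folklore] -/
theorem IsTopReg.prefix {v : List α} (u w : List α) (h : IsTopReg σ v) (huw : u ++ w = v) :
    IsTopReg σ u := by
  subst huw
  intro hu
  have := h (by simp [hu])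
  rwa [List.head_append_of_ne_nil] at this   -- may need fixing

/-- **Smallness at the top** for a nonempty word regular at `1`: `|I_W(x,b)| ≤ M_x^{|W|} (1-x)` for
`0 < x ≤ b < 1`, `M_x = topBound σ x` (the head-bounded refined bound of
`DrinfeldAssociatorTransport`, bounded letters those not at `1`). [folklore] -/
theorem iterInt_pden_le_of_isTopReg {W : List α} (hW : W ≠ []) (htop : IsTopReg σ W) {x b : ℝ}
    (hx : 0 < x) (hxb : x ≤ b) (hb : b < 1) :
    |iterInt (pden σ) W x b| ≤ topBound σ x ^ W.length * (1 - x) := by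
  have hM2 : 2 / x ≤ topBound σ x := (topBound_ge σ x).1
  have h2x : (2 : ℝ) ≤ 2 / x := by rw [le_div_iff₀ hx]; linarith [hxb.trans_lt hb]
  have hM1 : (1 : ℝ) ≤ topBound σ x := by linarith
  have hs' : IsOpen (Ioo (x / 2) 1) := isOpen_Ioo
  have hso' : (Ioo (x / 2) 1).OrdConnected := ordConnected_Ioo
  have hf' : ∀ c, ContinuousOn (pden σ c) (Ioo (x / 2) 1) := fun c =>
    (continuousOn_pden hσ c).mono (Ioo_subset_Ioo_left (by linarith))
  have h := abs_iterInt_le_of_head_bdd hs' hso' hf' (fun c => σ c ≠ 1) (K := 1) (M := topBound σ x)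
    zero_le_one (by linarith) ⟨by linarith, hb⟩ hb ?_ ?_ W hW (htop hW) (x := x)
    ⟨by linarith, hxb.trans_lt hb⟩ hxb
  · refine h.trans ?_
    have hq : countBdd (fun c => σ c ≠ 1) W ≤ W.length := List.length_filter_le _ _
    have hq1 : 1 ≤ countBdd (fun c => σ c ≠ 1) W := by
      have : W.head hW ∈ W.filter fun c => decide (σ c ≠ 1) :=
        List.mem_filter.mpr ⟨List.head_mem hW, by simpa using htop hW⟩
      exact List.length_pos_iff.mpr (List.ne_nil_of_mem this)
    have hx0 : 0 ≤ 1 - x := by linarith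
    have hx1 : 1 - x ≤ 1 := by linarith
    rw [one_pow, one_mul]
    calc topBound σ x ^ countBdd (fun c => σ c ≠ 1) W * (1 - x) ^ countBdd (fun c => σ c ≠ 1) W
        ≤ topBound σ x ^ W.length * (1 - x) ^ 1 :=
          mul_le_mul (pow_le_pow_right₀ hM1 hq) (pow_le_pow_of_le_one hx0 hx1 hq1)
            (by positivity) (by positivity)
      _ = _ := by rw [pow_one]
  · -- bounded letters
    intro c hc t ht _
    by_cases hc0 : σ c = 0
    · rw [pden_of_eq_zero hc0 (by linarith [ht.1])]
      have ht0 : 0 < t := by linarith [ht.1]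
      rw [abs_of_pos (div_pos one_pos ht0)]
      calc 1 / t ≤ 2 / x := by rw [div_le_div_iff₀ ht0 hx]; linarith [ht.1]
        _ ≤ topBound σ x := hM2
    · have h1 : 1 < σ c := lt_of_le_of_ne ((hσ c).resolve_left hc0) (Ne.symm hc)
      rw [pden_of_ne_zero hσ hc0 ht.2, abs_of_pos (div_pos one_pos (by linarith [ht.2]))]
      calc 1 / (σ c - t) ≤ 1 / (σ c - 1) := one_div_le_one_div_of_le (by linarith) (by linarith [ht.2])
        _ ≤ topBound σ x - 2 / x := (topBound_ge σ x).2 c h1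
        _ ≤ topBound σ x := by linarith [(by positivity : 0 ≤ 2 / x)]
  · -- the letter at `1`
    intro c hc t ht _
    have hc1 : σ c = 1 := by simpa using hc
    rw [pden_of_ne_zero hσ (by rw [hc1]; norm_num) ht.2, hc1,
      abs_of_pos (div_pos one_pos (by linarith [ht.2]))]

omit [Fintype α] [DecidableEq α] in
/-- `L_w` increases with `b` (nonnegative densities). [folklore] -/
theorem hlog_mono {w : List α} (hw : IsReg σ w) {b b' : ℝ} (hb : b ∈ Ioo (0 : ℝ) 1)
    (hb' : b' ∈ Ioo (0 : ℝ) 1) (hbb' : b ≤ b') : hlog σ w b ≤ hlog σ w b' := by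
  classical
  rw [hlog_chen hσ hw hb hb', ← Finset.add_sum_erase _ _ (NCSeries.nil_self_mem_splits w),
    iterInt_nil, one_mul]
  refine le_add_of_nonneg_right (Finset.sum_nonneg fun p hp => mul_nonneg ?_ ?_)
  · exact iterInt_pden_nonneg p.1 hb.1 hbb' hb'.2
  · exact hlog_nonneg hσ (hw.suffix σ p.1 p.2 (NCSeries.mem_splits.mp (Finset.mem_erase.mp hp).2)) hb

omit [Fintype α] [DecidableEq α] in
/-- Crude logarithmic growth at the top: `L_v(b) ≤ (|v|+1) 4^{|v|} (1 + |log(1-b)|)^{|v|}` for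
`b ∈ [1/2, 1)`. [folklore] -/
theorem hlog_le_log_pow {v : List α} (hv : IsReg σ v) {b : ℝ} (hb1 : 1 / 2 ≤ b) (hb : b < 1) :
    hlog σ v b ≤ (v.length + 1) * 4 ^ v.length * (1 + |Real.log (1 - b)|) ^ v.length := by
  classical
  have hb' : b ∈ Ioo (0 : ℝ) 1 := ⟨by linarith, hb⟩
  have hhalf : (1 / 2 : ℝ) ∈ Ioo (0 : ℝ) 1 := by norm_num
  rw [hlog_chen hσ hv hhalf hb']
  have hcard : (NCSeries.splits v).card ≤ v.length + 1 := by
    rw [NCSeries.splits, Finset.card_map]; simp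
  refine (Finset.sum_le_card_nsmul _ _ (4 ^ v.length * (1 + |Real.log (1 - b)|) ^ v.length) ?_).trans ?_
  · intro p hp
    rw [NCSeries.mem_splits] at hp
    have hlen1 : p.1.length ≤ v.length := by
      have := congrArg List.length hp; simp at this; omega
    have hlen2 : p.2.length ≤ v.length := by
      have := congrArg List.length hp; simp at this; omega
    have h1 : iterInt (pden σ) p.1 (1 / 2) b ≤ (1 + |Real.log (1 - b)|) ^ v.length := by
      refine (iterInt_pden_le_pow hσ p.1 (by norm_num) hb1 hb).trans ?_
      refine (pow_le_pow_left₀ (by positivity) ?_ _).trans (pow_le_pow_right₀ ?_ hlen1)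
      · linarith [KZ3.abs_log_half_le]
      · linarith [abs_nonneg (Real.log (1 - b))]
    have h2 : hlog σ p.2 (1 / 2) ≤ 4 ^ v.length := by
      refine (hlog_le hσ (hv.suffix σ p.1 p.2 hp) hhalf).trans ?_
      norm_num
      exact pow_le_pow_right₀ (by norm_num) hlen2
    calc iterInt (pden σ) p.1 (1 / 2) b * hlog σ p.2 (1 / 2)
        ≤ (1 + |Real.log (1 - b)|) ^ v.length * 4 ^ v.length :=
          mul_le_mul h1 h2 (hlog_nonneg hσ (hv.suffix σ p.1 p.2 hp) hhalf) (by positivity)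
      _ = _ := by ring
  · rw [nsmul_eq_mul, ← mul_assoc]
    refine mul_le_mul_of_nonneg_right (mul_le_mul_of_nonneg_right ?_ (by positivity)) (by positivity)
    exact_mod_cast hcard

/-- Uniform bound at the top for a DOUBLY regular word (regular at `0` and at `1`):
`L_W(b) ≤ (|W|+1) (4 M)^{|W|}` for `b ∈ (1/2, 1)`, `M = topBound σ (1/2)`. [folklore] -/
theorem hlog_le_of_isTopReg {W : List α} (hW : IsReg σ W) (htop : IsTopReg σ W) {b : ℝ}
    (hb : b ∈ Ioo (1 / 2 : ℝ) 1) :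
    hlog σ W b ≤ (W.length + 1) * (4 * topBound σ (1 / 2)) ^ W.length := by
  classical
  have hb' : b ∈ Ioo (0 : ℝ) 1 := ⟨by linarith [hb.1], hb.2⟩
  have hhalf : (1 / 2 : ℝ) ∈ Ioo (0 : ℝ) 1 := by norm_num
  have hM1 : (1 : ℝ) ≤ topBound σ (1 / 2) := by
    have := (topBound_ge σ (1 / 2)).1; norm_num at this; linarith
  rw [hlog_chen hσ hW hhalf hb']
  have hcard : (NCSeries.splits W).card ≤ W.length + 1 := by
    rw [NCSeries.splits, Finset.card_map]; simp
  refine (Finset.sum_le_card_nsmul _ _ ((4 * topBound σ (1 / 2)) ^ W.length) ?_).trans ?_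
  · intro p hp
    rw [NCSeries.mem_splits] at hp
    have hlen1 : p.1.length ≤ W.length := by
      have := congrArg List.length hp; simp at this; omega
    have hlen2 : p.2.length ≤ W.length := by
      have := congrArg List.length hp; simp at this; omega
    have h1 : iterInt (pden σ) p.1 (1 / 2) b ≤ topBound σ (1 / 2) ^ W.length := by
      by_cases hp1 : p.1 = []
      · rw [hp1, iterInt_nil]; exact one_le_pow₀ hM1
      · refine (le_abs_self _).trans ((iterInt_pden_le_of_isTopReg hσ hp1 (htop.prefix p.1 p.2 hp)
          (by norm_num) hb.1.le hb.2).trans ?_)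
        calc topBound σ (1 / 2) ^ p.1.length * (1 - 1 / 2) ≤ topBound σ (1 / 2) ^ p.1.length * 1 :=
              mul_le_mul_of_nonneg_left (by norm_num) (by positivity)
          _ ≤ topBound σ (1 / 2) ^ W.length := by rw [mul_one]; exact pow_le_pow_right₀ hM1 hlen1
    have h2 : hlog σ p.2 (1 / 2) ≤ 4 ^ W.length := by
      refine (hlog_le hσ (hW.suffix σ p.1 p.2 hp) hhalf).trans ?_
      norm_num
      exact pow_le_pow_right₀ (by norm_num) hlen2
    calc iterInt (pden σ) p.1 (1 / 2) b * hlog σ p.2 (1 / 2)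
        ≤ topBound σ (1 / 2) ^ W.length * 4 ^ W.length :=
          mul_le_mul h1 h2 (hlog_nonneg hσ (hW.suffix σ p.1 p.2 hp) hhalf) (by positivity)
      _ = (4 * topBound σ (1 / 2)) ^ W.length := by rw [mul_pow]; ring
  · rw [nsmul_eq_mul]
    refine mul_le_mul_of_nonneg_right ?_ (by positivity)
    exact_mod_cast hcard

/-- **The value at `1`** of a doubly regular word: `L_W(1) := sup_{b<1} L_W(b) = lim_{b→1⁻} L_W(b)`
(the generalised multiple-polylogarithm values of the letter configuration; for the alphabet `{0,1}`
the multiple zeta values `ζ(W) = Li_W(1)`, [Brown 2009, Def. 5.10]). [cite: BrownENS2009, §5.5 Def. 5.10] -/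
def hlogAt1 (σ : α → ℝ) (W : List α) : ℝ := sSup ((hlog σ W) '' Ioo (1 / 2) 1)

/-- The family `b ↦ L_W(b)` is bounded above on `(1/2,1)` for a doubly regular word. [folklore] -/
theorem bddAbove_hlog {W : List α} (hW : IsReg σ W) (htop : IsTopReg σ W) :
    BddAbove ((hlog σ W) '' Ioo (1 / 2 : ℝ) 1) := by
  refine ⟨(W.length + 1) * (4 * topBound σ (1 / 2)) ^ W.length, ?_⟩
  rintro _ ⟨b, hb, rfl⟩
  exact hlog_le_of_isTopReg hσ hW htop hb

/-- **`L_W(b) → L_W(1)` as `b → 1⁻`** for a doubly regular word. [cite: BrownENS2009, §5.5 Def. 5.10] -/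
theorem tendsto_hlogAt1 {W : List α} (hW : IsReg σ W) (htop : IsTopReg σ W) :
    Tendsto (hlog σ W) (𝓝[<] 1) (𝓝 (hlogAt1 σ W)) := by
  have hmono : MonotoneOn (hlog σ W) (Ioo (1 / 2 : ℝ) 1) := fun b hb b' hb' hle =>
    hlog_mono hσ hW ⟨by linarith [hb.1], hb.2⟩ ⟨by linarith [hb'.1], hb'.2⟩ hle
  exact hmono.tendsto_nhdsWithin_Ioo_left (nonempty_Ioo.mpr (by norm_num)) (bddAbove_hlog hσ hW htop)

/-- `L_W(b) ≤ L_W(1)` for `b ∈ (1/2,1)`. [folklore] -/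
theorem hlog_le_hlogAt1 {W : List α} (hW : IsReg σ W) (htop : IsTopReg σ W) {b : ℝ}
    (hb : b ∈ Ioo (1 / 2 : ℝ) 1) : hlog σ W b ≤ hlogAt1 σ W :=
  le_csSup (bddAbove_hlog hσ hW htop) ⟨b, hb, rfl⟩

/-- `L_∅(1) = 1`. [folklore] -/
theorem hlogAt1_nil : hlogAt1 σ ([] : List α) = 1 := by
  refine tendsto_nhds_unique (tendsto_hlogAt1 hσ (isReg_nil σ) (fun h => (h rfl).elim)) ?_
  refine (tendsto_const_nhds (x := (1 : ℝ))).congr' ?_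
  filter_upwards [Ioo_mem_nhdsLT (zero_lt_one' ℝ)] with b hb
  exact (hlog_nil hσ hb).symm

/-- **Rate at the top**: `0 ≤ L_W(1) - L_W(b) ≤ C_W (1 + |log(1-b)|)^{|W|} (1-b)` for `b ∈ [1/2,1)`,
`C_W = (|W|+1)² 4^{|W|} M_{1/2}^{|W|}… ` (Chen at `b` and smallness at the top). [folklore] -/
theorem hlogAt1_sub_le {W : List α} (hW : IsReg σ W) (htop : IsTopReg σ W) {b : ℝ}
    (hb : b ∈ Ioo (1 / 2 : ℝ) 1) :
    0 ≤ hlogAt1 σ W - hlog σ W b ∧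
      hlogAt1 σ W - hlog σ W b ≤ (W.length + 1) * (topBound σ b ^ W.length *
        ((W.length + 1) * 4 ^ W.length * (1 + |Real.log (1 - b)|) ^ W.length)) * (1 - b) := by
  classical
  refine ⟨sub_nonneg.2 (hlog_le_hlogAt1 hσ hW htop hb), ?_⟩
  have hb' : b ∈ Ioo (0 : ℝ) 1 := ⟨by linarith [hb.1], hb.2⟩
  -- for `b < b' < 1`: `L_W(b') - L_W(b) = Σ_{u ≠ ∅} I_u(b,b') L_v(b) ≤ bound · (1-b)`
  have hkey : ∀ b' ∈ Ioo b 1, hlog σ W b' - hlog σ W b ≤ (W.length + 1) * (topBound σ b ^ W.length *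
      ((W.length + 1) * 4 ^ W.length * (1 + |Real.log (1 - b)|) ^ W.length)) * (1 - b) := by
    intro b' hbb'
    have hb'' : b' ∈ Ioo (0 : ℝ) 1 := ⟨hb'.1.trans hbb'.1, hbb'.2⟩
    rw [hlog_chen hσ hW hb' hb'', ← Finset.add_sum_erase _ _ (NCSeries.nil_self_mem_splits W),
      iterInt_nil, one_mul, add_sub_cancel_left]
    have hcard : ((NCSeries.splits W).erase ([], W)).card ≤ W.length + 1 := by
      refine (Finset.card_erase_le).trans ?_
      rw [NCSeries.splits, Finset.card_map]; simp
    refine (Finset.sum_le_card_nsmul _ _ (topBound σ b ^ W.length *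
      ((W.length + 1) * 4 ^ W.length * (1 + |Real.log (1 - b)|) ^ W.length) * (1 - b)) ?_).trans ?_
    · intro p hp
      obtain ⟨hne, hp⟩ := Finset.mem_erase.mp hp
      rw [NCSeries.mem_splits] at hp
      have hp1 : p.1 ≠ [] := by
        intro h1; apply hne; ext1
        · exact h1
        · simpa [h1] using hp
      have hlen1 : p.1.length ≤ W.length := by
        have := congrArg List.length hp; simp at this; omega
      have hlen2 : p.2.length ≤ W.length := by
        have := congrArg List.length hp; simp at this; omega
      have hM1 : (1 : ℝ) ≤ topBound σ b := by
        have := (topBound_ge σ b).1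
        have h2 : (2 : ℝ) ≤ 2 / b := by rw [le_div_iff₀ hb'.1]; linarith [hb.2]
        linarith
      have h1 : iterInt (pden σ) p.1 b b' ≤ topBound σ b ^ W.length * (1 - b) := by
        refine (le_abs_self _).trans ((iterInt_pden_le_of_isTopReg hσ hp1 (htop.prefix p.1 p.2 hp)
          hb'.1 hbb'.1.le hbb'.2).trans ?_)
        exact mul_le_mul_of_nonneg_right (pow_le_pow_right₀ hM1 hlen1) (by linarith [hb.2])
      have h2 : hlog σ p.2 b ≤ (W.length + 1) * 4 ^ W.length * (1 + |Real.log (1 - b)|) ^ W.length := by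
        refine (hlog_le_log_pow hσ (hW.suffix σ p.1 p.2 hp) hb.1.le hb.2).trans ?_
        have hL : 1 ≤ 1 + |Real.log (1 - b)| := by linarith [abs_nonneg (Real.log (1 - b))]
        have e1 : (p.2.length : ℝ) + 1 ≤ W.length + 1 := by exact_mod_cast Nat.succ_le_succ hlen2
        have e2 : (4 : ℝ) ^ p.2.length ≤ 4 ^ W.length := pow_le_pow_right₀ (by norm_num) hlen2
        have e3 : (1 + |Real.log (1 - b)|) ^ p.2.length ≤ (1 + |Real.log (1 - b)|) ^ W.length :=
          pow_le_pow_right₀ hL hlen2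
        exact mul_le_mul (mul_le_mul e1 e2 (by positivity) (by positivity)) e3 (by positivity)
          (by positivity)
      calc iterInt (pden σ) p.1 b b' * hlog σ p.2 b
          ≤ (topBound σ b ^ W.length * (1 - b)) *
              ((W.length + 1) * 4 ^ W.length * (1 + |Real.log (1 - b)|) ^ W.length) :=
            mul_le_mul h1 h2 (hlog_nonneg hσ (hW.suffix σ p.1 p.2 hp) hb') (by
              have : 0 ≤ 1 - b := by linarith [hb.2]
              positivity)
        _ = _ := by ring
    · rw [nsmul_eq_mul, ← mul_assoc]
      have hT0 : 0 ≤ topBound σ b := by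
        have := (topBound_ge σ b).1
        have h2 : (0 : ℝ) ≤ 2 / b := by have := hb'.1.le; positivity
        linarith
      refine mul_le_mul_of_nonneg_right (mul_le_mul_of_nonneg_right ?_ (by positivity)) (by linarith [hb.2])
      exact_mod_cast hcard
  have ht : Tendsto (fun b' => hlog σ W b' - hlog σ W b) (𝓝[<] 1) (𝓝 (hlogAt1 σ W - hlog σ W b)) :=
    (tendsto_hlogAt1 hσ hW htop).sub_const _
  refine le_of_tendsto ht ?_
  filter_upwards [Ioo_mem_nhdsLT hb.2] with b' hb'2
  exact hkey b' hb'2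

end TopEndpoint

/-! ### Two-sided regularisation of `L(b)` and the regularised values at `1`
(the generalised Drinfeld associator of a real alphabet) -/

section TwoSided

variable [Fintype α] [DecidableEq α]

/-- **The two-sided regularised hyperlogarithms** `⟨L(b), reg_{z,o} W⟩ = Σ_v (reg_{z,o} W)_v L_v(b)`
(IKZ's two-sided regularisation `Shuffle.reg`, end letter `z` at `0`, front letter `o` at `1`).
[cite: IharaKanekoZagier2006, §3 (reg_ш)] -/
def hlogReg2 (σ : α → ℝ) (z o : α) (W : List α) (b : ℝ) : ℝ :=
  Shuffle.pair (fun v => hlog σ v b) (Shuffle.reg z o W)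

/-- **The regularised values at `1`** `Z^σ_W = Σ_v (reg_{z,o} W)_v L_v(1)` — the generalised Drinfeld
associator of the real alphabet `σ` (for `{0,1}`: `Z(reg W) = ζ_ш(W)`, the shuffle-regularised
multiple zeta values, `genAssoc_boolLetters`) [Brown 2009, §5.5: `Reg(L(z), 1)` and Def. 5.10].
[cite: BrownENS2009, §5.5 Def. 5.10] -/
def genAssoc (σ : α → ℝ) (z o : α) (W : List α) : ℝ :=
  Shuffle.pair (hlogAt1 σ) (Shuffle.reg z o W)

variable {σ} {z o : α} (hz : σ z = 0) (hσz : ∀ c, c ≠ z → 1 ≤ σ c) (ho : σ o = 1)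
  (hσo : ∀ c, c ≠ o → σ c ≠ 1)
include hz hσz ho hσo

omit [Fintype α] [DecidableEq α] hσz hσo in
/-- `z ≠ o`. [folklore] -/
theorem z_ne_o : z ≠ o := fun h => by
  have := congrArg σ h; rw [hz, ho] at this; exact zero_ne_one this

omit [Fintype α] hz hσz ho in
/-- Words in the support of `reg_{z,o} W` are regular at `1`. [folklore] -/
theorem isTopReg_of_mem_support_reg (W : List α) {v : List α} (hv : v ∈ (Shuffle.reg z o W).support) :
    IsTopReg σ v := by
  intro hne
  have h := Shuffle.head?_ne_of_mem_support_reg z o W hv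
  rw [List.head?_eq_some_head hne] at h
  exact hσo _ (fun heq => h (by rw [heq]))

omit [Fintype α] ho hσo in
/-- Words in the support of `reg_{z,o} W` are regular at `0`. [folklore] -/
theorem isReg_of_mem_support_reg (hzo : z ≠ o) (W : List α) {v : List α}
    (hv : v ∈ (Shuffle.reg z o W).support) : IsReg σ v :=
  (isReg_iff_getLast?_ne σ hz hσz).2 (Shuffle.getLast?_ne_of_mem_support_reg hzo W hv)

omit [Fintype α] [DecidableEq α] hz hσz hσo in
/-- `L_{o}(b) = ∫_0^b dt/(1-t) = -log(1-b)`. [folklore] -/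
theorem hlog_one_letter {b : ℝ} (hb : b ∈ Ioo (0 : ℝ) 1) (hσ : ∀ c, σ c = 0 ∨ 1 ≤ σ c) :
    hlog σ [o] b = -Real.log (1 - b) := by
  have hreg : IsReg σ [o] := (isReg_singleton σ).2 (by rw [ho]; norm_num)
  rw [hlog_cons hσ hreg hb]
  have h : ∫ t in (0 : ℝ)..b, pden σ o t * hlog σ [] t = ∫ t in (0 : ℝ)..b, (1 - t)⁻¹ := by
    refine intervalIntegral.integral_congr_ae ?_
    rw [uIoc_of_le hb.1.le]
    refine ae_of_all _ fun t ht => ?_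
    have ht' : t ∈ Ioo (0 : ℝ) 1 := ⟨ht.1, ht.2.trans_lt hb.2⟩
    rw [hlog_nil hσ ht', mul_one, pden_of_ne_zero hσ (by rw [ho]; norm_num) ht'.2, ho, one_div]
  rw [h, intervalIntegral.integral_comp_sub_left (fun t => t⁻¹) 1, integral_inv_of_pos (by linarith [hb.2])
    (by norm_num), sub_zero, one_div, Real.log_inv]

omit [Fintype α] hσo in
/-- `L(b)_{[o]} = -log(1-b)`. [folklore] -/
theorem hlogSeries_one_letter {b : ℝ} (hb : b ∈ Ioo (0 : ℝ) 1) : hlogSeries σ z b [o] = -Real.log (1 - b) := by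
  rw [hlogSeries_apply_of_isReg hz hσz ((isReg_singleton σ).2 (by rw [ho]; norm_num)),
    hlog_one_letter ho hb (adm_of_zero_letter σ hz hσz)]

omit [Fintype α] ho hσo in
/-- `L(b)_{[z]} = log b`. [folklore] -/
theorem hlogSeries_zero_letter {b : ℝ} (hb : b ∈ Ioo (0 : ℝ) 1) : hlogSeries σ z b [z] = Real.log b := by
  have h := hlogSeries_replicate (z := z) (adm_of_zero_letter σ hz hσz) 1 hb
  rw [List.replicate_one] at h
  rw [h]; simp

omit [Fintype α] hσo in
/-- `⟨L(b), reg W⟩ = ⟨(v ↦ L_v(b)), reg W⟩` (the support of `reg` consists of regular words). [folklore] -/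
theorem pair_hlogSeries_reg (W : List α) (b : ℝ) :
    Shuffle.pair (hlogSeries σ z b) (Shuffle.reg z o W) = hlogReg2 σ z o W b :=
  Shuffle.pair_congr fun _ hv =>
    hlogSeries_apply_of_isReg hz hσz (isReg_of_mem_support_reg hz hσz (z_ne_o hz ho) W hv) b

omit [Fintype α] hσo in
/-- The two-sided regularised series is `exp(log(1-b) o) · L(b) · exp(-log b · z)`
(`Shuffle.factorisation` for the group-like `L(b)`). [cite: IharaKanekoZagier2006, §3 with Cor. 5] -/
theorem hlogReg2_eq {b : ℝ} (hb : b ∈ Ioo (0 : ℝ) 1) :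
    (show NCSeries α ℝ from fun W => hlogReg2 σ z o W b) =
      Shuffle.expLetter o (Real.log (1 - b)) * hlogSeries σ z b * Shuffle.expLetter z (-Real.log b) := by
  funext W
  have h := Shuffle.factorisation (isGroupLike_hlogSeries hz hσz hb) (z_ne_o hz ho) W
  rw [hlogSeries_one_letter hz hσz ho hb, hlogSeries_zero_letter hz hσz hb, neg_neg,
    pair_hlogSeries_reg hz hσz ho] at h
  exact h.symm

omit [Fintype α] hσo in
/-- **Two-sided factorisation of the hyperlogarithm series**:
`L(b) = exp(-log(1-b) · o) · ⟨L(b), reg_{z,o} ·⟩ · exp(log b · z)` on `(0,1)` — the real-alphabet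
form of the factorisation `(1-z)^{-x₁}… · Φ · … z^{x₀}` of the generating series of polylogarithms
through the regularised series [Furusho2003, Prop. 3.2.3 (method)]. [cite: IharaKanekoZagier2006, §3 with Cor. 5] -/
theorem hlogSeries_factorisation {b : ℝ} (hb : b ∈ Ioo (0 : ℝ) 1) :
    hlogSeries σ z b = Shuffle.expLetter o (-Real.log (1 - b)) *
      (show NCSeries α ℝ from fun W => hlogReg2 σ z o W b) * Shuffle.expLetter z (Real.log b) := by
  rw [hlogReg2_eq hz hσz ho hb]
  simp only [← mul_assoc]
  rw [Shuffle.expLetter_neg_mul_expLetter, one_mul, mul_assoc, Shuffle.expLetter_neg_mul_expLetter,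
    mul_one]

omit [Fintype α] hσo in
/-- `W ↦ ⟨L(b), reg W⟩` is group-like. [folklore] -/
theorem isGroupLike_hlogReg2 {b : ℝ} (hb : b ∈ Ioo (0 : ℝ) 1) :
    NCSeries.IsGroupLike (show NCSeries α ℝ from fun W => hlogReg2 σ z o W b) := by
  rw [hlogReg2_eq hz hσz ho hb]
  exact ((Shuffle.isGroupLike_expLetter o _).mul (isGroupLike_hlogSeries hz hσz hb)).mul
    (Shuffle.isGroupLike_expLetter z _)

/-- **`⟨L(b), reg W⟩ → Z^σ_W` as `b → 1⁻`** (every word in the support of `reg W` is doubly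
regular). [cite: BrownENS2009, §5.5 Def. 5.10] -/
theorem tendsto_hlogReg2 (W : List α) :
    Tendsto (hlogReg2 σ z o W) (𝓝[<] 1) (𝓝 (genAssoc σ z o W)) := by
  have hσ := adm_of_zero_letter σ hz hσz
  show Tendsto (fun b => Shuffle.pair (fun v => hlog σ v b) (Shuffle.reg z o W)) (𝓝[<] 1)
    (𝓝 (genAssoc σ z o W))
  unfold genAssoc Shuffle.pair Finsupp.sum
  refine tendsto_finsetSum _ fun v hv => ?_
  exact (tendsto_hlogAt1 hσ (isReg_of_mem_support_reg hz hσz (z_ne_o hz ho) W hv)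
    (isTopReg_of_mem_support_reg hσo W hv)).const_smul _

/-- **The generalised associator is group-like** (`Z^σ_∅ = 1` and the shuffle relations
`Z^σ_u Z^σ_v = Σ_{w ∈ u ш v} Z^σ_w`). [folklore] -/
theorem isGroupLike_genAssoc : NCSeries.IsGroupLike (genAssoc σ z o) := by
  have hev : ∀ᶠ b in 𝓝[<] (1 : ℝ), b ∈ Ioo (0 : ℝ) 1 := Ioo_mem_nhdsLT (zero_lt_one' ℝ)
  refine ⟨?_, fun u v => ?_⟩
  · refine tendsto_nhds_unique (tendsto_hlogReg2 hz hσz ho hσo []) ?_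
    refine (tendsto_const_nhds (x := (1 : ℝ))).congr' ?_
    filter_upwards [hev] with b hb
    exact ((isGroupLike_hlogReg2 hz hσz ho hb).1).symm
  · have h1 := (tendsto_hlogReg2 hz hσz ho hσo u).mul (tendsto_hlogReg2 hz hσz ho hσo v)
    have h2 : Tendsto (fun b => ((MZV.shuffleWord u v).map fun w => hlogReg2 σ z o w b).sum) (𝓝[<] 1)
        (𝓝 ((MZV.shuffleWord u v).map (genAssoc σ z o)).sum) :=
      tendsto_list_sum _ fun w _ => tendsto_hlogReg2 hz hσz ho hσo w
    refine tendsto_nhds_unique h1 (h2.congr' ?_)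
    filter_upwards [hev] with b hb
    exact ((isGroupLike_hlogReg2 hz hσz ho hb).2 u v).symm

/-- `Z^σ_∅ = 1`. [folklore] -/
theorem genAssoc_nil : genAssoc σ z o [] = 1 := (isGroupLike_genAssoc hz hσz ho hσo).1

omit hz hσz ho hσo

/-- A binary word is regular at `1` iff it is a top word of `KZ3`. [folklore] -/
theorem isTopReg_boolLetters_iff (w : List Bool) : IsTopReg boolLetters w ↔ KZ3.IsTopWord w := by
  constructor
  · intro h
    by_cases hw : w = []
    · exact Or.inl hw
    · right
      rw [List.head?_eq_some_head hw]
      have := h hw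
      simp only [boolLetters] at this
      cases hh : w.head hw
      · rfl
      · rw [hh] at this; simp at this
  · intro h hne
    rw [h.head_eq hne]; simp [boolLetters]

/-- For the alphabet `{0,1}` and a convergent word, `L_V(1) = ζ(V)`. [cite: BrownENS2009, §5.5 Def. 5.10] -/
theorem hlogAt1_boolLetters {V : List Bool} (hV : KZ3.IsConvWord V) :
    hlogAt1 boolLetters V = multipleZeta (MZV.ofBinaryWord V) :=
  tendsto_nhds_unique (tendsto_hlogAt1 boolLetters_adm ((isReg_boolLetters_iff V).2 hV.2)
    ((isTopReg_boolLetters_iff V).2 hV.1)) (tendsto_hlog_boolLetters_multipleZeta hV)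

/-- **The case `{0,1}`: the regularised values at `1` are the shuffle-regularised multiple zeta
values** `Z^{0,1}_W = Z(reg W) = Σ_v (reg W)_v ζ(v)` (`MZV.zetaWordSum (MZV.shuffleReg W)`, i.e.
`(-1)^{dp W}` times the coefficient of `W` in `drinfeldAssociator`) [Furusho2003, Prop. 3.2.3;
Brown 2009, §5.5 "the regularised value of `L(z)` at `1` is Drinfeld's associator"].
[cite: BrownENS2009, §5.5] -/
theorem genAssoc_boolLetters (W : List Bool) :
    genAssoc boolLetters false true W = MZV.zetaWordSum (MZV.shuffleReg W) := by
  have hconv : ∀ v ∈ (Shuffle.reg false true W).support, KZ3.IsConvWord v := by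
    intro v hv
    obtain ⟨h1, h2⟩ := Shuffle.support_reg_subset (by decide) W hv
    refine ⟨?_, ?_⟩
    · by_cases hvn : v = []
      · exact Or.inl hvn
      · right
        rw [List.head?_eq_some_head hvn] at h1 ⊢
        cases hh : v.head hvn
        · rfl
        · rw [hh] at h1; exact absurd rfl h1
    · by_cases hvn : v = []
      · exact Or.inl hvn
      · right
        rw [List.getLast?_eq_some_getLast hvn] at h2 ⊢
        cases hh : v.getLast hvn
        · rw [hh] at h2; exact absurd rfl h2
        · rfl
  rw [genAssoc, MZV.zetaWordSum, ← Shuffle.reg_false_true_eq_shuffleReg]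
  unfold Shuffle.pair
  refine Finsupp.sum_congr fun v hv => ?_
  rw [Rat.smul_def, hlogAt1_boolLetters (hconv v hv)]

end TwoSided

end Hyperlog

end Literature.NumberTheory.Transcendental
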